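import Literature.Computability.ImplicitComplexity.SoftTypeAssignment
import HarnessLib

/-!
# `STA₊` terms: the σ-calculus of de Bruijn substitution and stability of `→βγ`

Companion to `SoftTypeAssignment.lean` (the systems `STA`/`STA₊` of Gaboardi–Marion–Ronchi Della
Rocca 2008 = GMR08, in de Bruijn form). This file is the substitution metatheory every later
result about `STA₊` rests on (subject reduction, standardization, the simulation theorems behind
`STAPlusCapturesNP`):

* the algebra of renamings and parallel substitutions on `STA.Term` (`rename_rename`,
  `substp_rename`, `rename_substp`, `substp_substp`, `substp_var`), i.e. the usual σ-calculus
  identities for de Bruijn terms, and the two commutation laws of the β-rule's single substitution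
  `M[N/x]` (`subst0_rename`, `subst0_substp`);
* stability of one-step reduction `→βγ` (GMR08 Def. 5.2) under renaming and substitution
  (`Red.rename`, `Red.substp`), and the congruence / substitutivity properties of its
  reflexive–transitive closure `Reduces` (`Reduces.app`, `Reduces.lam`, `Reduces.sum`,
  `Reduces.substp_of_pointwise`, `Reduces.subst0`).

All statements are folklore facts about the untyped calculus `Λ₊` (λ-calculus with an erratic
choice `M + N`, reduction the contextual closure of `β`, `M + N → M`, `M + N → N`); no typing is
involved. Proofs are the standard structural inductions (Autosubst-style lifting lemmas first).

## References

* [GaboardiMarionRonchidellarocca2008] M. Gaboardi, J.-Y. Marion, S. Ronchi Della Rocca, *Soft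
  Linear Logic and Polynomial Complexity Classes*, ENTCS 205 (2008), Def. 3.1 (ii) (β and
  `M[N/x]`), Def. 5.1–5.2 (`Λ₊`, `→βγ`).
-/

namespace Literature.Computability.ImplicitComplexity

namespace STA

/-! ### Renamings -/

/-- Lifting the identity renaming is the identity. [folklore] -/
theorem liftRen_id : liftRen id = id := by
  funext i
  cases i <;> rfl

/-- Lifting commutes with composition of renamings. [folklore] -/
theorem liftRen_comp (ρ₁ ρ₂ : ℕ → ℕ) : liftRen (ρ₂ ∘ ρ₁) = liftRen ρ₂ ∘ liftRen ρ₁ := by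
  funext i
  cases i <;> rfl

/-- A lifted renaming acts on shifted indices as the original renaming, shifted. [folklore] -/
theorem liftRen_comp_succ (ρ : ℕ → ℕ) : liftRen ρ ∘ Nat.succ = Nat.succ ∘ ρ := by
  funext i
  rfl

namespace Term

/-! ### Renaming and substitution: the σ-calculus identities -/

/-- Renaming by the identity does nothing. [folklore] -/
theorem rename_id (M : Term) : M.rename id = M := by
  induction M with
  | var i => rfl
  | app M N ihM ihN => simp [Term.rename, ihM, ihN]
  | lam M ih => simp [Term.rename, liftRen_id, ih]
  | sum M N ihM ihN => simp [Term.rename, ihM, ihN]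

/-- Two renamings compose. [folklore] -/
theorem rename_rename (M : Term) (ρ₁ ρ₂ : ℕ → ℕ) :
    (M.rename ρ₁).rename ρ₂ = M.rename (ρ₂ ∘ ρ₁) := by
  induction M generalizing ρ₁ ρ₂ with
  | var i => rfl
  | app M N ihM ihN => simp [Term.rename, ihM, ihN]
  | lam M ih => simp [Term.rename, ih, liftRen_comp]
  | sum M N ihM ihN => simp [Term.rename, ihM, ihN]

/-- Lifting a substitution after a lifted renaming. [folklore] -/
theorem up_comp_liftRen (τ : ℕ → Term) (ρ : ℕ → ℕ) : Term.up τ ∘ liftRen ρ = Term.up (τ ∘ ρ) := by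
  funext i
  cases i <;> rfl

/-- Substituting into a renamed term. [folklore] -/
theorem substp_rename (M : Term) (ρ : ℕ → ℕ) (τ : ℕ → Term) :
    (M.rename ρ).substp τ = M.substp (τ ∘ ρ) := by
  induction M generalizing ρ τ with
  | var i => rfl
  | app M N ihM ihN => simp [Term.rename, Term.substp, ihM, ihN]
  | lam M ih => simp [Term.rename, Term.substp, ih, up_comp_liftRen]
  | sum M N ihM ihN => simp [Term.rename, Term.substp, ihM, ihN]

/-- Renaming a lifted substitution by a lifted renaming. [folklore] -/
theorem up_rename (τ : ℕ → Term) (ρ : ℕ → ℕ) :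
    (fun i => (Term.up τ i).rename (liftRen ρ)) = Term.up (fun i => (τ i).rename ρ) := by
  funext i
  cases i with
  | zero => rfl
  | succ i =>
    show ((τ i).rename Nat.succ).rename (liftRen ρ) = ((τ i).rename ρ).rename Nat.succ
    rw [rename_rename, rename_rename, liftRen_comp_succ]

/-- Renaming a substituted term. [folklore] -/
theorem rename_substp (M : Term) (τ : ℕ → Term) (ρ : ℕ → ℕ) :
    (M.substp τ).rename ρ = M.substp (fun i => (τ i).rename ρ) := by
  induction M generalizing τ ρ with
  | var i => rfl
  | app M N ihM ihN => simp [Term.rename, Term.substp, ihM, ihN]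
  | lam M ih =>
    simp only [Term.rename, Term.substp]
    rw [ih, up_rename]
  | sum M N ihM ihN => simp [Term.rename, Term.substp, ihM, ihN]

/-- Lifting commutes with composition of substitutions. [folklore] -/
theorem up_substp (τ₁ τ₂ : ℕ → Term) :
    (fun i => (Term.up τ₁ i).substp (Term.up τ₂)) = Term.up (fun i => (τ₁ i).substp τ₂) := by
  funext i
  cases i with
  | zero => rfl
  | succ i =>
    show ((τ₁ i).rename Nat.succ).substp (Term.up τ₂) = ((τ₁ i).substp τ₂).rename Nat.succ
    rw [substp_rename, rename_substp]
    rfl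

/-- Two substitutions compose. [folklore] -/
theorem substp_substp (M : Term) (τ₁ τ₂ : ℕ → Term) :
    (M.substp τ₁).substp τ₂ = M.substp (fun i => (τ₁ i).substp τ₂) := by
  induction M generalizing τ₁ τ₂ with
  | var i => rfl
  | app M N ihM ihN => simp [Term.substp, ihM, ihN]
  | lam M ih =>
    simp only [Term.substp]
    rw [ih, up_substp]
  | sum M N ihM ihN => simp [Term.substp, ihM, ihN]

/-- Lifting the identity substitution is the identity substitution. [folklore] -/
theorem up_var : Term.up Term.var = Term.var := by
  funext i
  cases i <;> rfl

/-- The identity substitution does nothing. [folklore] -/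
theorem substp_var (M : Term) : M.substp Term.var = M := by
  induction M with
  | var i => rfl
  | app M N ihM ihN => simp [Term.substp, ihM, ihN]
  | lam M ih => simp [Term.substp, up_var, ih]
  | sum M N ihM ihN => simp [Term.substp, ihM, ihN]

/-- A renaming is the substitution of variables for variables. [folklore] -/
theorem rename_eq_substp (M : Term) (ρ : ℕ → ℕ) : M.rename ρ = M.substp (fun i => .var (ρ i)) := by
  have h := substp_rename M ρ Term.var
  rw [substp_var] at h
  exact h

/-- Two substitutions that agree pointwise act equally (trivial functional extensionality, kept
as a named rewriting principle). [folklore] -/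
theorem substp_congr {τ τ' : ℕ → Term} (h : ∀ i, τ i = τ' i) (M : Term) : M.substp τ = M.substp τ' := by
  rw [show τ = τ' from funext h]

/-! ### The β-substitution `M[N/x]` -/

/-- `M[N/x]` commutes with renaming: `(M[N/x])ρ = (M (⇑ρ))[Nρ/x]`. [folklore] -/
theorem subst0_rename (M N : Term) (ρ : ℕ → ℕ) :
    (M.subst0 N).rename ρ = (M.rename (liftRen ρ)).subst0 (N.rename ρ) := by
  unfold subst0
  rw [rename_substp, substp_rename]
  congr 1
  funext i
  cases i <;> rfl

/-- `M[N/x]` commutes with substitution: `(M[N/x])τ = (M (⇑τ))[Nτ/x]` (the substitution lemma).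
[folklore] -/
theorem subst0_substp (M N : Term) (τ : ℕ → Term) :
    (M.subst0 N).substp τ = (M.substp (Term.up τ)).subst0 (N.substp τ) := by
  unfold subst0
  rw [substp_substp, substp_substp]
  congr 1
  funext i
  cases i with
  | zero => rfl
  | succ i =>
    show τ i = ((τ i).rename Nat.succ).substp _
    rw [substp_rename]
    exact (substp_var (τ i)).symm

/-- Substituting for a variable that was just introduced by a shift recovers the term:
`(M↑)[N/x] = M`. [folklore] -/
theorem subst0_rename_succ (M N : Term) : (M.rename Nat.succ).subst0 N = M := by
  unfold subst0
  rw [substp_rename]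
  exact substp_var M

end Term

/-! ### Stability of `→βγ` under renaming and substitution -/

/-- `→βγ` is stable under renaming of free variables. [cite: GaboardiMarionRonchidellarocca2008, Def. 5.2] -/
theorem Red.rename {M N : Term} (h : Red M N) (ρ : ℕ → ℕ) : Red (M.rename ρ) (N.rename ρ) := by
  induction h generalizing ρ with
  | beta M N =>
    rw [Term.subst0_rename]
    exact Red.beta _ _
  | choiceL M N => exact Red.choiceL _ _
  | choiceR M N => exact Red.choiceR _ _
  | appL N _ ih => exact Red.appL _ (ih ρ)
  | appR M _ ih => exact Red.appR _ (ih ρ)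
  | lam _ ih => exact Red.lam (ih (liftRen ρ))
  | sumL N _ ih => exact Red.sumL _ (ih ρ)
  | sumR M _ ih => exact Red.sumR _ (ih ρ)

/-- `→βγ` is stable under substitution (it is the contextual closure of closed rule schemes).
[cite: GaboardiMarionRonchidellarocca2008, Def. 5.2] -/
theorem Red.substp {M N : Term} (h : Red M N) (τ : ℕ → Term) : Red (M.substp τ) (N.substp τ) := by
  induction h generalizing τ with
  | beta M N =>
    rw [Term.subst0_substp]
    exact Red.beta _ _
  | choiceL M N => exact Red.choiceL _ _
  | choiceR M N => exact Red.choiceR _ _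
  | appL N _ ih => exact Red.appL _ (ih τ)
  | appR M _ ih => exact Red.appR _ (ih τ)
  | lam _ ih => exact Red.lam (ih (Term.up τ))
  | sumL N _ ih => exact Red.sumL _ (ih τ)
  | sumR M _ ih => exact Red.sumR _ (ih τ)

/-- In particular `→βγ` is stable under `[N/x]`. [cite: GaboardiMarionRonchidellarocca2008, Def. 5.2] -/
theorem Red.subst0 {M M' : Term} (h : Red M M') (N : Term) : Red (M.subst0 N) (M'.subst0 N) :=
  h.substp _

/-! ### `Reduces = →βγ*`: congruence and substitutivity -/

namespace Reduces

/-- Reflexivity of `→βγ*`. [folklore] -/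
theorem rfl' (M : Term) : Reduces M M := Relation.ReflTransGen.refl

/-- A single step is a reduction. [folklore] -/
theorem single {M N : Term} (h : Red M N) : Reduces M N := Relation.ReflTransGen.single h

/-- Transitivity of `→βγ*`. [folklore] -/
theorem trans' {M N P : Term} (h₁ : Reduces M N) (h₂ : Reduces N P) : Reduces M P :=
  Relation.ReflTransGen.trans h₁ h₂

/-- Congruence of `→βγ*` in the function position. [folklore] -/
theorem appL {M M' : Term} (h : Reduces M M') (N : Term) : Reduces (.app M N) (.app M' N) := by
  induction h with
  | refl => exact Relation.ReflTransGen.refl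
  | tail _ hst ih => exact ih.tail (Red.appL N hst)

/-- Congruence of `→βγ*` in the argument position. [folklore] -/
theorem appR (M : Term) {N N' : Term} (h : Reduces N N') : Reduces (.app M N) (.app M N') := by
  induction h with
  | refl => exact Relation.ReflTransGen.refl
  | tail _ hst ih => exact ih.tail (Red.appR M hst)

/-- Congruence of `→βγ*` for applications. [folklore] -/
theorem app {M M' N N' : Term} (hM : Reduces M M') (hN : Reduces N N') :
    Reduces (.app M N) (.app M' N') :=
  (hM.appL N).trans' (appR M' hN)

/-- Congruence of `→βγ*` under `λ`. [folklore] -/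
theorem lam {M M' : Term} (h : Reduces M M') : Reduces (.lam M) (.lam M') := by
  induction h with
  | refl => exact Relation.ReflTransGen.refl
  | tail _ hst ih => exact ih.tail (Red.lam hst)

/-- Congruence of `→βγ*` in the left branch of a sum. [folklore] -/
theorem sumL {M M' : Term} (h : Reduces M M') (N : Term) : Reduces (.sum M N) (.sum M' N) := by
  induction h with
  | refl => exact Relation.ReflTransGen.refl
  | tail _ hst ih => exact ih.tail (Red.sumL N hst)

/-- Congruence of `→βγ*` in the right branch of a sum. [folklore] -/
theorem sumR (M : Term) {N N' : Term} (h : Reduces N N') : Reduces (.sum M N) (.sum M N') := by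
  induction h with
  | refl => exact Relation.ReflTransGen.refl
  | tail _ hst ih => exact ih.tail (Red.sumR M hst)

/-- Congruence of `→βγ*` for sums. [folklore] -/
theorem sum {M M' N N' : Term} (hM : Reduces M M') (hN : Reduces N N') :
    Reduces (.sum M N) (.sum M' N') :=
  (hM.sumL N).trans' (sumR M' hN)

/-- `→βγ*` is stable under renaming. [folklore] -/
theorem rename {M N : Term} (h : Reduces M N) (ρ : ℕ → ℕ) : Reduces (M.rename ρ) (N.rename ρ) := by
  induction h with
  | refl => exact Relation.ReflTransGen.refl
  | tail _ hst ih => exact ih.tail (hst.rename ρ)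

/-- `→βγ*` is stable under substitution. [folklore] -/
theorem substp {M N : Term} (h : Reduces M N) (τ : ℕ → Term) : Reduces (M.substp τ) (N.substp τ) := by
  induction h with
  | refl => exact Relation.ReflTransGen.refl
  | tail _ hst ih => exact ih.tail (hst.substp τ)

/-- Reducing inside the substituted terms: if `τ i →βγ* τ' i` for every `i` then
`M τ →βγ* M τ'`. [folklore] -/
theorem substp_of_pointwise (M : Term) {τ τ' : ℕ → Term} (h : ∀ i, Reduces (τ i) (τ' i)) :
    Reduces (M.substp τ) (M.substp τ') := by
  induction M generalizing τ τ' with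
  | var i => exact h i
  | app M N ihM ihN => exact app (ihM h) (ihN h)
  | lam M ih =>
    refine lam (ih fun i => ?_)
    cases i with
    | zero => exact Relation.ReflTransGen.refl
    | succ i => exact (h i).rename Nat.succ
  | sum M N ihM ihN => exact sum (ihM h) (ihN h)

/-- `→βγ*` is a congruence for `M[N/x]` in both arguments. [folklore] -/
theorem subst0 {M M' N N' : Term} (hM : Reduces M M') (hN : Reduces N N') :
    Reduces (M.subst0 N) (M'.subst0 N') := by
  refine (hM.substp _).trans' (substp_of_pointwise M' fun i => ?_)
  cases i with
  | zero => exact hN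
  | succ i => exact Relation.ReflTransGen.refl

end Reduces

/-- A β-redex reduces to its contractum inside `→βγ*` after reducing its parts.
[cite: GaboardiMarionRonchidellarocca2008, Def. 5.2] -/
theorem Reduces.beta {M M' N N' : Term} (hM : Reduces M M') (hN : Reduces N N') :
    Reduces (.app (.lam M) N) (M'.subst0 N') :=
  ((Reduces.app (Reduces.lam hM) hN).tail (Red.beta M' N'))

end STA

end Literature.Computability.ImplicitComplexity
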